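import Summits.Ventures.PercRepro.RankLevelSetUpColoop
import Summits.Ventures.PercRepro.RankLevelSetUpSeriesClassFour

/-! # RankLevelSetUpResidue — (↑) AT EVERY LEVEL `≤ 4` ON EVERY MATROID OF NULLITY `≤ 4`, AND (★★) AT LEVEL `5` FOR
EVERY FINITE MATROID, MODULO THE CLAIM ON ELEMENTARY QUOTIENT PAIRS (night-1 g38; dossier §50; on
`RankLevelSetUpColoop` and `RankLevelSetUpSeriesClassFour`)

The pieces assemble by strong induction on `#E`: a level below the nullity is empty (**`upAt_of_lt_nullity`**), level
`0` is empty (**`upAt_zero`**); coloops are removed by `upAt_of_isColoop` / `upAt_self_of_isColoop`; on a coloop-free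
matroid of nullity `≤ 3` the chain closes at every level (**`upAt_of_coloopFree_of_nullity_three`**); on a coloop-free
matroid of nullity `4` the level `4` is `upAt_four_of_no_triple` without a series triple and
`upAt_four_of_seriesClass` / `upAt_four_of_mem_seriesClass` with one — the latter under `UpSeriesClaim`. Hence
**`upAt_of_nullity_four_of_claim`**: (↑) at every level `k ≤ 4` with `2k + 2 ≤ #E` on every matroid of nullity
`≤ 4`, given the claim on every coloop-free matroid of nullity `4` with a series class of `≥ 3` elements. Through
`perElemAt_five_of_coloopFree_of_up_nullity` and the reductions of level `5` (loops, parallel pairs, coloops, as in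
`perElemAt_five_of_no_triple_aux`): **`perElemAt_five_of_claim`** — (★★) AT LEVEL `5` FOR EVERY FINITE MATROID
WITH `≥ 12` ELEMENTS, and **`mono_step_five_of_claim`** — Mono's step `5`, both modulo `UpSeriesClaim`. The claim
itself is census-clean on every loopless rank-`4` matroid with `≤ 9` elements (kit j332342) and is the whole residue of
level `5`. Every declaration has a docstring; imports: the cell's own modules and Mathlib only. Axioms: standard. -/

namespace PercRepro

open Set Matroid

variable {α : Type} (M : Matroid α) [M.Finite]

/-! ## Trivial levels -/

/-- **(↑) at a level below the nullity is trivial**: a bi-independent `k`-set spans `M✶`, so `k ≥ rk M✶`. -/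
lemma upAt_of_lt_nullity {b : α} {k : ℕ} (hk : (k : ℕ∞) < M✶.eRank) : BiIndepUpAt M b k := by
  unfold BiIndepUpAt
  have : {W ∈ biIndep M k | b ∈ W} = ∅ := by
    rw [Set.eq_empty_iff_forall_notMem]
    rintro W ⟨hW, -⟩
    have hsp : M✶.Spanning W := by
      rw [biIndep_eq_biSpan_dual] at hW
      exact hW.2.2.1
    have h1 := eRank_le_encard_of_spanning hsp
    have hWfin : W.Finite := M.ground_finite.subset hW.1
    rw [← hWfin.cast_ncard_eq, hW.2.1] at h1
    exact absurd hk (not_lt.mpr h1)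
  rw [this, Set.ncard_empty]
  exact Nat.zero_le _

/-- **(↑) at level `0` is trivial**: no `0`-set contains `b`. -/
lemma upAt_zero (b : α) : BiIndepUpAt M b 0 := by
  unfold BiIndepUpAt
  have : {W ∈ biIndep M 0 | b ∈ W} = ∅ := by
    rw [Set.eq_empty_iff_forall_notMem]
    rintro W ⟨hW, hbW⟩
    have hWfin : W.Finite := M.ground_finite.subset hW.1
    have h0 : W.ncard = 0 := hW.2.1
    rw [Set.ncard_eq_zero hWfin] at h0
    rw [h0] at hbW
    exact hbW
  rw [this, Set.ncard_empty]
  exact Nat.zero_le _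

/-- **(↑) at level `1` on a coloop-free matroid of nullity `≤ 2`** (`4 ≤ #E`): the chain with the coloop bound
`ρ − 1 ≤ 1`. -/
lemma upAt_one_of_coloopFree (hcol : ∀ e, ¬ M.IsColoop e) (hν : M✶.eRank ≤ 2) {b : α} (hb : b ∈ M.E)
    (hn : 4 ≤ M.E.ncard) : BiIndepUpAt M b 1 := by
  refine upAt_of_bound_two M hb le_rfl hn ?_
  intro j _ hj W hW _
  rw [compl_closure_eq_dual_coloops M hW]
  have hYE : M.E \ W ⊆ M✶.E := by rw [Matroid.dual_ground]; exact Set.sdiff_subset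
  have hcard : (M.E \ W).ncard = M.E.ncard - j := by
    rw [Set.ncard_sdiff' hW.1 M.ground_finite, hW.2.1]
  have h := ncard_coloops_add_one_le (N := M✶) hYE
    (fun e he => dual_isNonloop_of_coloopFree M hcol he.1)
    (ρ := 2) ((M✶.eRk_le_eRank _).trans hν) (by omega)
  omega

/-- **(↑) AT EVERY LEVEL ON A COLOOP-FREE MATROID OF NULLITY `≤ 3`** (`2k + 2 ≤ #E`). -/
theorem upAt_of_coloopFree_of_nullity_three (hcol : ∀ e, ¬ M.IsColoop e) (hν : M✶.eRank ≤ 3) {b : α}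
    (hb : b ∈ M.E) {k : ℕ} (hn : 2 * k + 2 ≤ M.E.ncard) : BiIndepUpAt M b k := by
  rcases Nat.lt_or_ge k 2 with hk | hk
  · rcases Nat.lt_or_ge k 1 with hk0 | hk1
    · have : k = 0 := by omega
      subst this
      exact upAt_zero M b
    · have : k = 1 := by omega
      subst this
      rcases le_or_gt M✶.eRank 2 with h2 | h2
      · exact upAt_one_of_coloopFree M hcol h2 hb (by omega)
      · refine upAt_of_lt_nullity M ?_
        calc ((1 : ℕ) : ℕ∞) < 2 := by norm_num
          _ < M✶.eRank := h2
  · exact upAt_of_nullity_three M hcol hν hb hk hn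

omit [M.Finite] in
/-- A nullity `≤ 4` which is not `≤ 3` is exactly `4`. -/
lemma eRank_dual_eq_four_of_not_le_three (hν : M✶.eRank ≤ 4) (h3 : ¬ M✶.eRank ≤ 3) : M✶.eRank = 4 := by
  have hne : M✶.eRank ≠ ⊤ := ne_top_of_le_ne_top (by decide) hν
  obtain ⟨m, hm⟩ := ENat.ne_top_iff_exists.mp hne
  rw [← hm] at hν h3 ⊢
  have h1 : m ≤ 4 := by exact_mod_cast hν
  have h2 : ¬ m ≤ 3 := fun h => h3 (by exact_mod_cast h)
  have : m = 4 := by omega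
  rw [this]; rfl

/-- **A series triple gives a series class of `≥ 3` elements.** -/
lemma three_le_ncard_seriesClass_of_not_noSeriesTriple (hnt : ¬ NoSeriesTriple M) :
    ∃ p ∈ M.E, 3 ≤ (M✶.closure {p}).ncard := by
  unfold NoSeriesTriple at hnt
  simp only [not_forall, not_false_eq_true, exists_prop] at hnt
  obtain ⟨p, q, r, hpq, hpr, hqr, hp, hq, hr, -⟩ := hnt
  refine ⟨p, by rw [← Matroid.dual_ground]; exact hp.mem_ground, ?_⟩
  have hpP : p ∈ M✶.closure {p} := M✶.mem_closure_of_mem' rfl hp.mem_ground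
  have hfin : (M✶.closure {p}).Finite := M.ground_finite.subset (M✶.closure_subset_ground _)
  have hsub : ({p, q, r} : Set α) ⊆ M✶.closure {p} := by
    intro x hx
    rcases hx with rfl | rfl | hx
    · exact hpP
    · exact hq
    · rw [Set.mem_singleton_iff] at hx; rw [hx]; exact hr
  have h3 : ({p, q, r} : Set α).ncard = 3 := by
    rw [Set.ncard_insert_of_notMem (by simp [hpq, hpr]) (Set.toFinite _), Set.ncard_pair hqr]
  calc 3 = ({p, q, r} : Set α).ncard := h3.symm
    _ ≤ (M✶.closure {p}).ncard := Set.ncard_le_ncard hsub hfin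

/-! ## The assembly -/

/-- **(↑) AT EVERY LEVEL `k ≤ 4` ON EVERY MATROID OF NULLITY `≤ 4`, GIVEN THE CLAIM** on every coloop-free matroid
of nullity `4` with a series class of `≥ 3` elements, at every element outside the class (`2k + 2 ≤ #E`): strong
induction on `#E`, removing coloops (`upAt_of_isColoop`, `upAt_self_of_isColoop` with `biIndepMono_of_nullity`);
on a coloop-free matroid: nullity `≤ 3` by the chain, nullity `4` and `k < 4` trivially, `k = 4` by
`upAt_four_of_no_triple` or the series-class theorems. -/
theorem upAt_of_nullity_four_of_claim
    (hclaim : ∀ (N : Matroid α) [N.Finite], (∀ e, ¬ N.IsColoop e) → N✶.eRank = 4 → ∀ p ∈ N.E,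
      3 ≤ (N✶.closure {p}).ncard → ∀ b ∈ N.E, b ∉ N✶.closure {p} → 10 ≤ N.E.ncard → UpSeriesClaim N✶ p b) :
    ∀ n : ℕ, ∀ (M' : Matroid α) [M'.Finite], M'.E.ncard = n → M'✶.eRank ≤ 4 → ∀ k : ℕ, k ≤ 4 → 2 * k + 2 ≤ n →
      ∀ b ∈ M'.E, BiIndepUpAt M' b k := by
  intro n
  induction n using Nat.strong_induction_on with
  | _ n ih =>
    intro M' _ hn hν k hk4 hkn b hb
    by_cases hcol : ∃ c, M'.IsColoop c
    · obtain ⟨c, hc⟩ := hcol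
      haveI := delete_finite' M' c
      have hcard : (M'.delete {c}).E.ncard = n - 1 := by
        rw [Matroid.delete_ground, Set.ncard_sdiff_singleton_of_mem hc.mem_ground, hn]
      have hν' : (M'.delete {c})✶.eRank ≤ 4 := (eRank_dual_delete_isColoop_le M' hc).trans hν
      rcases Nat.lt_or_ge k 1 with hk0 | hk1
      · have : k = 0 := by omega
        subst this
        exact upAt_zero M' b
      obtain ⟨k', rfl⟩ : ∃ k', k = k' + 1 := ⟨k - 1, by omega⟩
      by_cases hbc : b = c
      · subst hbc
        exact upAt_self_of_isColoop M' hc (by omega) (biIndepMono_of_nullity (M'.delete {b}) hν')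
      · have hbM : b ∈ (M'.delete {c}).E := by
          rw [Matroid.delete_ground]; exact ⟨hb, by simpa using hbc⟩
        refine upAt_of_isColoop M' hc hbc ?_ ?_
        · rcases Nat.lt_or_ge (2 * (k' + 1) + 2) n with hlt | hge
          · exact ih (n - 1) (by omega) (M'.delete {c}) hcard hν' (k' + 1) hk4 (by omega) b hbM
          · -- the exact middle of `M' ＼ c`
            rw [upAt_iff_through_le_through _ hbM (by omega), hcard]
            have e : n - 1 - 1 - (k' + 1) = k' + 1 := by omega
            rw [e]
        · exact ih (n - 1) (by omega) (M'.delete {c}) hcard hν' k' (by omega) (by omega) b hbM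
    · simp only [not_exists] at hcol
      by_cases h3 : M'✶.eRank ≤ 3
      · exact upAt_of_coloopFree_of_nullity_three M' hcol h3 hb (by omega)
      · have h4 : M'✶.eRank = 4 := eRank_dual_eq_four_of_not_le_three M' hν h3
        rcases Nat.lt_or_ge k 4 with hk | hk
        · refine upAt_of_lt_nullity M' ?_
          rw [h4]; exact_mod_cast hk
        · have hk' : k = 4 := by omega
          subst hk'
          by_cases hnt : NoSeriesTriple M'
          · exact upAt_four_of_no_triple M' hcol hν hnt hb (by omega)
          · obtain ⟨p, hp, hq⟩ := three_le_ncard_seriesClass_of_not_noSeriesTriple M' hnt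
            by_cases hbP : b ∈ M'✶.closure {p}
            · exact upAt_four_of_mem_seriesClass M' hcol h4 hp hq hbP
            · exact upAt_four_of_seriesClass M' hcol h4 hp hq hb hbP (by omega)
                (hclaim M' hcol h4 p hp hq b hb hbP (by omega))

/-- **(★★) AT LEVEL `5` ON A COLOOP-FREE MATROID AT AN ELEMENT IN NO PARALLEL PAIR, GIVEN THE CLAIM** (`11 < #E`). -/
theorem perElemAt_five_of_coloopFree_of_claim
    (hclaim : ∀ (N : Matroid α) [N.Finite], (∀ e, ¬ N.IsColoop e) → N✶.eRank = 4 → ∀ p ∈ N.E,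
      3 ≤ (N✶.closure {p}).ncard → ∀ b ∈ N.E, b ∉ N✶.closure {p} → 10 ≤ N.E.ncard → UpSeriesClaim N✶ p b)
    (hcol : ∀ e, ¬ M.IsColoop e) {y : α} (hy : y ∈ M.E) (hnp : ∀ z, z ≠ y → y ∉ M.closure {z})
    (hn : 2 * 5 + 1 < M.E.ncard) :
    {Z ∈ biIndep M 5 | y ∉ Z}.ncard ≤ {Q ∈ biIndep M 6 | y ∈ Q}.ncard :=
  perElemAt_five_of_coloopFree_of_up_nullity M hcol hy hnp hn
    (fun N _ hν hn10 b hb => upAt_of_nullity_four_of_claim hclaim N.E.ncard N rfl hν 4 le_rfl hn10 b hb)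

/-- **(★★) AT LEVEL `5` FOR EVERY FINITE MATROID WITH `≥ 12` ELEMENTS, GIVEN THE CLAIM**: the reductions of
`perElemAt_five_of_no_triple_aux` (a loop kills every level, a parallel pair sends level `5` to level `4` of the
minor, a coloop splits into the levels `4` and `5` of its deletion) on top of
`perElemAt_five_of_coloopFree_of_claim`. -/
theorem perElemAt_five_of_claim_aux
    (hclaim : ∀ (N : Matroid α) [N.Finite], (∀ e, ¬ N.IsColoop e) → N✶.eRank = 4 → ∀ p ∈ N.E,
      3 ≤ (N✶.closure {p}).ncard → ∀ b ∈ N.E, b ∉ N✶.closure {p} → 10 ≤ N.E.ncard → UpSeriesClaim N✶ p b) :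
    ∀ n : ℕ, ∀ (M' : Matroid α) [M'.Finite], M'.E.ncard = n →
      ∀ y ∈ M'.E, 12 ≤ n → {Z ∈ biIndep M' 5 | y ∉ Z}.ncard ≤ {Q ∈ biIndep M' 6 | y ∈ Q}.ncard := by
  intro n
  induction n using Nat.strong_induction_on with
  | _ n ih =>
    intro M' _ hn y hy h12
    by_cases hloop : ∃ ℓ, M'.IsLoop ℓ
    · obtain ⟨ℓ, hℓ⟩ := hloop
      have : {Z ∈ biIndep M' 5 | y ∉ Z} = ∅ := by
        rw [biIndep_eq_empty_of_isLoop M' hℓ 5]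
        ext Z; simp
      rw [this, Set.ncard_empty]
      exact Nat.zero_le _
    simp only [not_exists] at hloop
    by_cases hpar : ∃ u v, ParallelPair M' u v
    · obtain ⟨u, v, huv⟩ := hpar
      haveI := contract_delete_finite M' u v
      have hcard := ncard_ground_contract_delete M' huv
      have hD : ∀ {u v : α} (h : ParallelPair M' u v),
          biIndepCount ((M'.contract {u}).delete {v}) 4 ≤ biIndepCount ((M'.contract {u}).delete {v}) 5 := by
        intro u v h
        haveI := contract_delete_finite M' u v
        have hc := ncard_ground_contract_delete M' h
        exact biIndepCount_four_le_five ((M'.contract {u}).delete {v}) (by rw [hc]; omega)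
      by_cases hyu : y = u
      · subst hyu
        exact perElem_succ_of_parallel_self M' huv 4 (hD huv)
      by_cases hyv : y = v
      · subst hyv
        exact perElem_succ_of_parallel_self M' huv.symm 4 (hD huv.symm)
      · have hyN : y ∈ ((M'.contract {u}).delete {v}).E := by
          rw [ground_contract_delete]
          exact ⟨hy, by simp only [Set.mem_insert_iff, Set.mem_singleton_iff, not_or]; exact ⟨hyu, hyv⟩⟩
        exact perElem_succ_of_parallel_other M' huv hyu hyv 4
          (perElemAt_four ((M'.contract {u}).delete {v}) hyN (by rw [hcard]; omega))
    simp only [not_exists] at hpar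
    by_cases hcol : ∃ x, M'.IsColoop x
    · obtain ⟨x, hx⟩ := hcol
      haveI := delete_finite' M' x
      have hcard : (M'.delete {x}).E.ncard = n - 1 := by
        rw [Matroid.delete_ground, Set.ncard_sdiff_singleton_of_mem hx.mem_ground, hn]
      by_cases hyx : y = x
      · subst hyx
        exact (perElem_coloop_self M' hx 5).le
      · have hyM : y ∈ (M'.delete {x}).E := by
          rw [Matroid.delete_ground]
          exact ⟨hy, by simpa using hyx⟩
        refine perElem_succ_of_coloop M' hx hyx 4 (perElemAt_four (M'.delete {x}) hyM (by omega)) ?_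
        rcases Nat.lt_or_ge (n - 1) 12 with h11 | h12'
        · exact (perElem_middle_eq (M'.delete {x}) hyM 5 (by omega)).le
        · exact ih (n - 1) (by omega) (M'.delete {x}) hcard y hyM h12'
    simp only [not_exists] at hcol
    exact perElemAt_five_of_coloopFree_of_claim M' hclaim hcol hy
      (fun _ hz => notMem_closure_singleton_of_no_partner M' hy (hloop y) (hpar y) hz) (by omega)

/-- **(★★) AT LEVEL `5` FOR EVERY FINITE MATROID AND EVERY ELEMENT, GIVEN THE CLAIM** (`12 ≤ #E`). -/
theorem perElemAt_five_of_claim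
    (hclaim : ∀ (N : Matroid α) [N.Finite], (∀ e, ¬ N.IsColoop e) → N✶.eRank = 4 → ∀ p ∈ N.E,
      3 ≤ (N✶.closure {p}).ncard → ∀ b ∈ N.E, b ∉ N✶.closure {p} → 10 ≤ N.E.ncard → UpSeriesClaim N✶ p b)
    {y : α} (hy : y ∈ M.E) (hn : 12 ≤ M.E.ncard) :
    {Z ∈ biIndep M 5 | y ∉ Z}.ncard ≤ {Q ∈ biIndep M 6 | y ∈ Q}.ncard :=
  perElemAt_five_of_claim_aux hclaim M.E.ncard M rfl y hy hn

/-- **MONO'S STEP `j = 5` FOR EVERY FINITE MATROID, GIVEN THE CLAIM**: `(#E − 5) · D_5 ≤ 6 · D_6` for `12 ≤ #E`. -/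
theorem mono_step_five_of_claim
    (hclaim : ∀ (N : Matroid α) [N.Finite], (∀ e, ¬ N.IsColoop e) → N✶.eRank = 4 → ∀ p ∈ N.E,
      3 ≤ (N✶.closure {p}).ncard → ∀ b ∈ N.E, b ∉ N✶.closure {p} → 10 ≤ N.E.ncard → UpSeriesClaim N✶ p b)
    (hn : 12 ≤ M.E.ncard) : (M.E.ncard - 5) * biIndepCount M 5 ≤ 6 * biIndepCount M 6 :=
  mono_step_of_perElemAt M 5 (fun _ hy => perElemAt_five_of_claim M hclaim hy hn)

end PercRepro
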